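import Literature.MathematicalPhysics.QuantumFieldTheory.Balaban1983to89.B9Eq3126H1kPiSupRowClosed
import Literature.MathematicalPhysics.QuantumFieldTheory.Balaban1983to89.B9Eq347LocalLetterAdjoint
import Literature.MathematicalPhysics.QuantumFieldTheory.Balaban1983to89.B9Eq349BlockMultipliers
import Literature.MathematicalPhysics.QuantumFieldTheory.Balaban1983to89.B9Eq326G1SupRowAdjoint
import Literature.MathematicalPhysics.QuantumFieldTheory.Balaban1983to89.B9Eq326LocalPartTowerSupDecayDiagonalClosed
import Literature.MathematicalPhysics.QuantumFieldTheory.Balaban1983to89.B9Eq347GlobalFromLocal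

/-!
# `Balaban1983to89.B9Eq3126H1kPiAdjointRowClosed` — T. Bałaban, *Propagators for lattice gauge theories in a background field*, Commun. Math. Phys. **99** (1985) 389–434
# [Balaban1985BackgroundPropagators] (3.126) p. 420, (3.133) p. 422, Thm 3.12 p. 423, Thm 3.1 (3.42)∕(3.47) pp. 397–398, (3.49) p. 399, p. 391 *«The adjoints are taken
# with respect to natural L² scalar products»*; [Balaban1985Variational] (46) p. 285, (85) p. 291 (`H*J`), (88)–(89) p. 291 (`H*Δ_πA′`): **THE ADJOINT (COLUMN) LETTERS OF
# `H̃_k = G̃_kQ_k†(Q_kG̃_kQ_k†)⁻¹` ON THE CELL's MODEL — LOCAL AND GLOBAL sup → sup letters of `H̃_k†` (fine currents → coarse block fields) with ONE HEIGHT-FREE CONSTANT,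
# ∃-FIRST** — (K81) `B9Eq3126H1kPiSupRowClosed.exists_local_letter_H1LatticeKPi` (ne9-leaf-05 g88) TRANSPOSED by ne9-leaf-03's `B9Eq347LocalLetterAdjoint.local_adjoint` at the
# duality price (fine bond-block mass)∕(coarse weight) `= d·c₁∕c₁ = d` on the diagonal (NOT the `(L^{n+1})^d` of a fine → fine transposition), then summed by (G)
# `B9Eq347GlobalFromLocal.norm_apply_le_of_local`; the `H*` letter of [B11] (85)∕(88)∕(89)'s groups of `W = (δ/δA′)V` — a brick of the lattice-uniform (L3) slot

statement-level skeleton of published theorems with citation tags; proofs where landed; nothing here is a claim about the Yang–Mills mass gap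

CITATION HEADER (lean-in-tree rule).  Audit cell `pub-balaban`, sub-cell `t4`, BINDER row NE9; NE9 crux-team LEAF PROVER 01 (`b2b-balaban-t4-ne9-formalise-leaf-01`, gen 96;
(I-12); bears_on: R4/N22).  Composed BY NAME, nothing restated: (K81), `local_adjoint`, `B9Eq349BlockMultipliers.exists_block_clm_family`,
`B9Eq326G1SupRowAdjoint.adjoint_block_eq_self`, `B9Eq326LocalPartTowerSupDecayDiagonalClosed.sum_bondMass_bigBlock_le`, (G), `torusSum_le`.  Sources read through the audited
headers of (K81) ∕ (K62) (`paper:balaban1985-cmp99-background-propagators` pp. 391, 397–399, 420–423; `paper:balaban1985-cmp102-variational-background` pp. 285, 291).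
NOTHING of print's proof is reproduced; no constant of print is valued.

WHAT IS PROVED (sorry-free; proof lane — no `def`; [folklore] composition BY NAME).
* §1 **`exists_local_letter_adjoint_H1LatticeKPi`** — `∃ α₁ j₁ B δ` BEFORE (K81)'s binder block VERBATIM through `hQ`, then `(u g F hgu hgF y)`: for every fine current `g`
  supported over the big block `u` with `‖g‖_∞ ≤ F` and every coarse bond `y`: `‖(H̃_k†g)(y)‖ ≤ B·d·e^{−δ·d_m(y₋, u)}·F` (`H̃_k† = ContinuousLinearMap.adjoint` of
  `H1LatticeK hposπ hQ` in the weighted `L²` spaces).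
* §2 **`exists_global_adjoint_H1LatticeKPi`** — `∃ α₁ j₁ B`: for every fine current `g` with `‖g‖_∞ ≤ M` and every coarse bond `y`: `‖(H̃_k†g)(y)‖ ≤ B·M`.
HONEST SCOPE.  The adjoint of the coarse → fine letter only (its source side is coarse, so the transposition is height-free); NOT the adjoint-side words of `𝔊̃_k`
(fine → fine: `G̃_kD*_U`, `G̃_kcurl*_U` — located open, STOREY J); constants crude; `hpos′`, `hpos`, `hposπ`, `hQ`, the windows, the level data, `c₀ = η^d`, `‖J‖ ≤ j₀` stay
HYPOTHESES; nothing of [B9] Thm 3.12 or [B11] (46) asserted; «NE9 ⇐ the named binders»; NE9 NOT PRINTED ∕ NOT PROVED; row WALLED ON A MODEL (O-NE9-1; #5 UNRULED); spine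
PROVED 0∕9; rung (B)+1 on a finite T⁴ — NOT infinite volume, NOT mass gap, NOT BetaPertH, NOT Clay.  HONEST DEPENDENCY: continuum YM on T⁴ ⇐ BetaPertH ∧ nine spine
estimates (0/9 proved); BetaPertH ⇐ (D1) ∧ (D4) ∧ CAP+tail; G-an2-4 gates asym, D1 and NE2/3/4.  NEW file; nothing modified.  Net new unproved facts: 0.
-/

noncomputable section

set_option autoImplicit false

open scoped InnerProductSpace ComplexConjugate BigOperators

namespace Literature.MathematicalPhysics.QuantumFieldTheory.Balaban1983to89.B9Eq3126H1kPiAdjointRowClosed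

open B4Sect5Torus (TSite tdist torusSum_le tdist_symm)
open B4Sect5Proof (latticeConst latticeConst_nonneg)
open B9SectCLatticeCarrier (Bond bpos btgt unshift)
open B9Eq311L2Pairing (WL2)
open B9Eq319QprimeTorus (fineP blockCoord)
open B7Prop1Explicit (U1 Wcx boxVec)
open B11Eq103H1Complex (SiteL2K BondL2K H1LatticeK)
open B9Eq310DeltaPrime (plaqHolU)
open B9Eq310HessianOperator (adTransportW)
open B9Eq315QTorus (perCfg cornerSite)
open B9Eq315QTower (towerP UlevOf)
open B9Eq316TowerFlatIsOneStep (towerP_eq_fineP_pow siteCast)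
open B9Eq326OperatorTower (QkW laplaceAk)
open B9Eq3119DeltaPiTower (laplaceAkPi)
open B9Eq324DeltaPrimeATower (laplacePrimeAk)
open B9Eq3126H1kPiSupRowClosed (exists_local_letter_H1LatticeKPi)
open B9Eq347LocalLetterAdjoint (local_adjoint)
open B9Eq349BlockMultipliers (exists_block_clm_family)
open B9Eq326G1SupRowAdjoint (adjoint_block_eq_self)
open B9Eq326LocalPartTowerSupDecayDiagonalClosed (sum_bondMass_bigBlock_le)
open B9Eq347GlobalFromLocal (norm_apply_le_of_local)

variable {d : ℕ} (hd : 1 ≤ d) (L : ℕ) [NeZero L] (hL : 1 ≤ L) (hL3 : 3 ≤ L)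
  {𝔸 : Type*} [NormedRing 𝔸] [NormedAlgebra ℂ 𝔸] [CompleteSpace 𝔸] [NormOneClass 𝔸] [StarRing 𝔸] [NormedStarGroup 𝔸] [StarModule ℂ 𝔸]
  {W : Type*} [NormedAddCommGroup W] [InnerProductSpace ℂ W] [FiniteDimensional ℂ W] (φ : W ≃ₗ[ℂ] 𝔸)
  {Mφ Mφ' : ℝ} (hMφ : 0 ≤ Mφ) (hMφ' : 0 ≤ Mφ') (hφ : ∀ w, ‖φ w‖ ≤ Mφ * ‖w‖) (hφ' : ∀ X, ‖φ.symm X‖ ≤ Mφ' * ‖X‖) (hstar : ∀ X : 𝔸, ‖star X‖ ≤ ‖X‖)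
  {a : ℝ} (ha : 0 < a) {a' : ℝ} (ha' : 0 < a') {ϱ : ℝ} (hϱ0 : 0 ≤ ϱ) (hϱ1 : ϱ < 1)
  (τ : 𝔸 →ₗ[ℂ] ℂ) {Cτ : ℝ} (hτ : ∀ X, ‖τ X‖ ≤ Cτ * ‖X‖) (hCτ : 0 ≤ Cτ) {Mτ : ℝ} (hτm : ∀ X Y : 𝔸, ‖τ (X * Y)‖ ≤ Mτ * ‖X‖ * ‖Y‖) (hMτ : 0 ≤ Mτ)
  {ρw : ℝ} (hρw : 0 ≤ ρw)
  (hτ₁ : ∀ X : 𝔸, τ (star X) = conj (τ X)) (hτ₂ : ∀ X Y : 𝔸, τ (X * Y) = τ (Y * X)) (hφτ : ∀ X Y : 𝔸, ⟪φ.symm X, φ.symm Y⟫_ℂ = τ (star X * Y))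
  (AQ : ℝ)

/-! ## §1 The local letter of `H̃_k†` -/

set_option maxRecDepth 8192 in -- deep unfolding `laplaceAkPi` ↦ `laplaceALatticeK` when matching the adjoint term
set_option maxHeartbeats 800000 in -- the ≈ 50-binder block + the block families
include hd hL hL3 hMφ hMφ' hφ hφ' hstar ha ha' hϱ0 hϱ1 hτ hCτ hτm hMτ hρw hτ₁ hτ₂ hφτ in
/-- **THE LOCAL LETTER OF `H̃_k†` (fine currents → coarse block fields), HEIGHT-FREE**: (K81)'s letter (L)(H̃_k; B, δ) TRANSPOSED at the duality price `d`
(fine bond-block mass `d·c₁` over coarse weight `c₁`): for every fine current `g` supported over the big block `u` with `‖g‖_∞ ≤ F` and every coarse bond `y`,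
`‖(H̃_k†g)(y)‖ ≤ B·d·e^{−δ·d_m(y₋, u)}·F`. [cite: Balaban1985BackgroundPropagators, (3.126) p.420, Thm 3.12 p.423, (3.49) p.399, p.391; Balaban1985Variational, (85) p.291, (46) p.285] -/
theorem exists_local_letter_adjoint_H1LatticeKPi :
    ∃ α₁ j₁ B δ : ℝ, 0 < α₁ ∧ 0 < j₁ ∧ 0 ≤ B ∧ 0 < δ ∧
      ∀ (n : ℕ) (η : ℝ) (_hηL : η * (L : ℝ) ^ (n + 1) = 1) (c₀ c₁ : ℝ) [Fact (0 < c₀)] [Fact (0 < c₁)]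
        (_hw : c₀ * ((L : ℝ) ^ (n + 1)) ^ d = c₁) (_hρ : |η| ^ d / c₀ ≤ ρw) (m : Fin d → ℕ) [∀ i, NeZero (m i)] (_hm : ∀ i, 1 ≤ m i)
        (U : Bond d (towerP L m (n + 1)) → 𝔸ˣ) (αU : ℕ → ℝ) (_hα0 : ∀ j, 0 ≤ αU j) (hα1 : ∀ j, αU j ≤ 1 / 64)
        (hαL : ∀ j, 50 * (d + 1) * αU j * (L : ℝ) ^ d ≤ 1 / 2)
        (hU1 : ∀ (j : ℕ) (x : B7Prop1Explicit.Site d) (k : Fin d), perCfg (towerP L m (j + 1)) (UlevOf L m (n + 1) U j) x k ∈ U1 𝔸)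
        (hreg : ∀ (j : ℕ) (y : TSite d (towerP L m j)) (k : Fin d) (ρ' : Fin d → Fin L),
          ‖((Wcx L (perCfg (towerP L m (j + 1)) (UlevOf L m (n + 1) U j)) (cornerSite L y) k (boxVec L ρ') : 𝔸ˣ) : 𝔸) - 1‖ ≤ αU j)
        (εU : ℕ → ℝ) (_hεU : ∀ j, 0 ≤ εU j) (_hUε : ∀ (j : ℕ) (b : Bond d (towerP L m (j + 1))), ‖(UlevOf L m (n + 1) U j b : 𝔸) - 1‖ ≤ εU j)
        (_hLb : ∀ (j : ℕ) (b : Bond d (towerP L m (j + 1))), UlevOf L m (n + 1) U j b ∈ U1 𝔸)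
        (α : ℝ) (_hα : 0 ≤ α) (_hαle : α ≤ α₁)
        (hUst : ∀ b, star (U b : 𝔸) = (((U b)⁻¹ : 𝔸ˣ) : 𝔸)) (_hUb : ∀ b, U b ∈ U1 𝔸) (_hUη : ∀ b, ‖(U b : 𝔸) - 1‖ ≤ α * η)
        (_hpl : ∀ p : B9SectCLatticeCarrier.Plaq d (towerP L m (n + 1)), ‖(plaqHolU U p : 𝔸) - 1‖ ≤ α * η ^ 2)
        (_hUgrad : ∀ (x : TSite d (towerP L m (n + 1))) (μ : Fin d), ‖(U (x, μ) : 𝔸) - U (unshift μ x, μ)‖ ≤ α * η ^ 2)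
        (_hRlev : ∀ (j : ℕ) (b : Bond d (towerP L m (j + 1))) (w : W), ‖adTransportW φ (UlevOf L m (n + 1) U j) b w‖ ≤ ‖w‖)
        (_hεg : ∀ j < n + 1, εU j ≤ α * ϱ ^ j) (_hAQ : ∑ j ∈ Finset.range (n + 1), αU j ≤ AQ)
        (hpos' : ∀ x : SiteL2K ℂ d (towerP L m (n + 1)) c₀ W, x ≠ 0 → 0 < RCLike.re ⟪x, laplacePrimeAk L m n φ η U a' (c₁ := c₁) x⟫_ℂ)
        (hpos : ∀ x : BondL2K ℂ d (towerP L m (n + 1)) c₀ W, x ≠ 0 →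
          0 < RCLike.re ⟪x, laplaceAk L m n φ η U hL αU hα1 hU1 hreg τ (c₀ := c₀) (c₁ := c₁) a x⟫_ℂ)
        (_hc₀η : c₀ = η ^ d) (j₀ : ℝ) (_hJ : ∀ μ y, ‖B9Eq39Adjoint.J (fun μ => B9Eq33CovDerivVector.shiftEquiv μ) (fun μ y => U (y, μ)) η μ y‖ ≤ j₀) (_hj : j₀ ≤ j₁)
        (hposπ : ∀ x : BondL2K ℂ d (towerP L m (n + 1)) c₀ W, x ≠ 0 →
          0 < RCLike.re ⟪x, laplaceAkPi L m n φ τ η U a' hpos' hL αU hα1 hU1 hreg (c₁ := c₁) a x⟫_ℂ)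
        (hQ : Function.Surjective (QkW L m n φ U hL αU hα1 hU1 hreg (c₀ := c₀) (c₁ := c₁)))
        (u : TSite d m) (g : BondL2K ℂ d (towerP L m (n + 1)) c₀ W) (F : ℝ)
        (_hgu : ∀ b, blockCoord (L ^ (n + 1)) m (siteCast (towerP_eq_fineP_pow L m (n + 1)) (bpos b)) ≠ u →
          WL2.equiv ℂ (fun _ : Bond d (towerP L m (n + 1)) => c₀) W g b = 0)
        (_hgF : ∀ b, ‖WL2.equiv ℂ (fun _ : Bond d (towerP L m (n + 1)) => c₀) W g b‖ ≤ F) (y : Bond d m),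
        ‖WL2.equiv ℂ (fun _ : Bond d m => c₁) W
            (ContinuousLinearMap.adjoint (LinearMap.toContinuousLinearMap (H1LatticeK hposπ hQ)) g) y‖ ≤
          B * d * Real.exp (-(δ * tdist m (bpos y) u)) * F := by
  classical
  obtain ⟨α₁, j₁, B, δ, hα₁, hj₁, hB, hδ, HV⟩ :=
    exists_local_letter_H1LatticeKPi hd L hL hL3 φ hMφ hMφ' hφ hφ' hstar ha ha' hϱ0 hϱ1 τ hτ hCτ hτm hMτ hρw hτ₁ hτ₂ hφτ AQ
  refine ⟨α₁, j₁, B, δ, hα₁, hj₁, hB, hδ, ?_⟩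
  intro n η hηL c₀ c₁ _ _ hw hρ m _ hm U αU hα0 hα1 hαL hU1 hreg εU hεU hUε hLb α hα hαle hUst hUb hUη hpl hUgrad hRlev hεg hAQ hpos' hpos hc₀η j₀ hJ hj
    hposπ hQ u g F hgu hgF y
  have hc₀ : (0 : ℝ) < c₀ := Fact.out
  have hc₁ : (0 : ℝ) < c₁ := Fact.out
  have hL0 : (0 : ℝ) < L := by exact_mod_cast hL
  haveI : Nonempty (Bond d m) := ⟨y⟩
  haveI : Nonempty (Bond d (towerP L m (n + 1))) := ⟨(fun _ => 0, ⟨0, hd⟩)⟩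
  -- the two block families (coarse: bonds based at a site; fine: big blocks) and their self-adjointness
  obtain ⟨P, hP⟩ := exists_block_clm_family (𝕜 := ℂ) (w := fun _ : Bond d m => c₁) (V := W) (fun c : Bond d m => bpos c)
  obtain ⟨P', hP'⟩ := exists_block_clm_family (𝕜 := ℂ) (w := fun _ : Bond d (towerP L m (n + 1)) => c₀) (V := W)
    (fun b : Bond d (towerP L m (n + 1)) => blockCoord (L ^ (n + 1)) m (siteCast (towerP_eq_fineP_pow L m (n + 1)) (bpos b)))
  have hPadj : ∀ v, ContinuousLinearMap.adjoint (P v) = P v := fun v => adjoint_block_eq_self (P v) v (hP v)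
  have hP'adj : ∀ v, ContinuousLinearMap.adjoint (P' v) = P' v := fun v => adjoint_block_eq_self (P' v) v (hP' v)
  -- the fine bond-block mass `d·c₁`
  have hμ' : ∀ v : TSite d m, ∑ b : Bond d (towerP L m (n + 1)),
      (if blockCoord (L ^ (n + 1)) m (siteCast (towerP_eq_fineP_pow L m (n + 1)) (bpos b)) = v then c₀ else 0) ≤ d * c₁ := fun v => by
    have h := sum_bondMass_bigBlock_le L m n hc₀.le v
    calc _ ≤ c₀ * (d * ((L : ℝ) ^ (n + 1)) ^ d) := h
      _ = d * c₁ := by rw [← hw]; ring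
  -- (K81)'s letter for the CLM
  have hloc : ∀ (v : TSite d m) (f : BondL2K ℂ d m c₁ W) (F : ℝ), (∀ c, bpos c ≠ v → WL2.equiv ℂ (fun _ : Bond d m => c₁) W f c = 0) →
      (∀ c, ‖WL2.equiv ℂ (fun _ : Bond d m => c₁) W f c‖ ≤ F) →
      ∀ b, ‖WL2.equiv ℂ (fun _ : Bond d (towerP L m (n + 1)) => c₀) W (LinearMap.toContinuousLinearMap (H1LatticeK hposπ hQ) f) b‖ ≤
        B * Real.exp (-(δ * tdist m (blockCoord (L ^ (n + 1)) m (siteCast (towerP_eq_fineP_pow L m (n + 1)) (bpos b))) v)) * F := by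
    intro v f F hfv hfF b
    rw [LinearMap.coe_toContinuousLinearMap']
    exact HV n η hηL c₀ c₁ hw hρ m hm U αU hα0 hα1 hαL hU1 hreg εU hεU hUε hLb α hα hαle hUst hUb hUη hpl hUgrad hRlev hεg hAQ hpos' hpos hc₀η j₀ hJ hj
      hposπ hQ v f F hfv hfF b
  -- the transposition at the price `(√(d c₁)∕√c₁)² = d`
  have h := local_adjoint (hP := hP) (hP' := hP') (LinearMap.toContinuousLinearMap (H1LatticeK hposπ hQ)) (tdist m) (fun u v => tdist_symm hm u v)
    hPadj hP'adj hB hc₁ (fun _ => le_rfl) hμ' hloc u g F hgu hgF y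
  have hprice : B * Real.sqrt (d * c₁) / Real.sqrt c₁ * Real.sqrt (d * c₁) / Real.sqrt c₁ = B * d := by
    have h1 : Real.sqrt ((d : ℝ) * c₁) * Real.sqrt ((d : ℝ) * c₁) = d * c₁ := Real.mul_self_sqrt (by positivity)
    have h2 : Real.sqrt c₁ * Real.sqrt c₁ = c₁ := Real.mul_self_sqrt hc₁.le
    have hs : Real.sqrt (d * c₁) / Real.sqrt c₁ * Real.sqrt (d * c₁) / Real.sqrt c₁ = d := by
      calc Real.sqrt (d * c₁) / Real.sqrt c₁ * Real.sqrt (d * c₁) / Real.sqrt c₁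
          = (Real.sqrt (d * c₁) / Real.sqrt c₁) * (Real.sqrt (d * c₁) / Real.sqrt c₁) := by rw [mul_div_assoc]
        _ = (Real.sqrt (d * c₁) * Real.sqrt (d * c₁)) / (Real.sqrt c₁ * Real.sqrt c₁) := by rw [div_mul_div_comm]
        _ = (d * c₁) / c₁ := by rw [h1, h2]
        _ = d := by field_simp
    calc B * Real.sqrt (d * c₁) / Real.sqrt c₁ * Real.sqrt (d * c₁) / Real.sqrt c₁
        = B * (Real.sqrt (d * c₁) / Real.sqrt c₁ * Real.sqrt (d * c₁) / Real.sqrt c₁) := by ring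
      _ = B * d := by rw [hs]
  exact h.trans (le_of_eq (by rw [hprice]))

/-! ## §2 The global sup → sup letter of `H̃_k†` -/

set_option maxRecDepth 8192 in
set_option maxHeartbeats 400000 in -- the ≈ 50-binder block + one summation
include hd hL hL3 hMφ hMφ' hφ hφ' hstar ha ha' hϱ0 hϱ1 hτ hCτ hτm hMτ hρw hτ₁ hτ₂ hφτ in
/-- **THE GLOBAL sup → sup LETTER OF `H̃_k†`, ONE HEIGHT-FREE CONSTANT** ((3.47) from (3.42) *«and Lemma 2.1»* for the adjoint of (3.126)'s `H`): for every fine current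
`g` with `‖g‖_∞ ≤ M` and every coarse bond `y`, `‖(H̃_k†g)(y)‖ ≤ B·M` (`B = B₁·d·K_d(δ)`). [cite: Balaban1985BackgroundPropagators, Thm 3.1 (3.47) p.398, (3.126) p.420,
Thm 3.12 p.423; Balaban1985Variational, (85) p.291, (46) p.285] [cite: Balaban1984PropagatorsII, Lemma 2.1 (2.61) p.234] -/
theorem exists_global_adjoint_H1LatticeKPi :
    ∃ α₁ j₁ B : ℝ, 0 < α₁ ∧ 0 < j₁ ∧ 0 ≤ B ∧
      ∀ (n : ℕ) (η : ℝ) (_hηL : η * (L : ℝ) ^ (n + 1) = 1) (c₀ c₁ : ℝ) [Fact (0 < c₀)] [Fact (0 < c₁)]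
        (_hw : c₀ * ((L : ℝ) ^ (n + 1)) ^ d = c₁) (_hρ : |η| ^ d / c₀ ≤ ρw) (m : Fin d → ℕ) [∀ i, NeZero (m i)] (_hm : ∀ i, 1 ≤ m i)
        (U : Bond d (towerP L m (n + 1)) → 𝔸ˣ) (αU : ℕ → ℝ) (_hα0 : ∀ j, 0 ≤ αU j) (hα1 : ∀ j, αU j ≤ 1 / 64)
        (hαL : ∀ j, 50 * (d + 1) * αU j * (L : ℝ) ^ d ≤ 1 / 2)
        (hU1 : ∀ (j : ℕ) (x : B7Prop1Explicit.Site d) (k : Fin d), perCfg (towerP L m (j + 1)) (UlevOf L m (n + 1) U j) x k ∈ U1 𝔸)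
        (hreg : ∀ (j : ℕ) (y : TSite d (towerP L m j)) (k : Fin d) (ρ' : Fin d → Fin L),
          ‖((Wcx L (perCfg (towerP L m (j + 1)) (UlevOf L m (n + 1) U j)) (cornerSite L y) k (boxVec L ρ') : 𝔸ˣ) : 𝔸) - 1‖ ≤ αU j)
        (εU : ℕ → ℝ) (_hεU : ∀ j, 0 ≤ εU j) (_hUε : ∀ (j : ℕ) (b : Bond d (towerP L m (j + 1))), ‖(UlevOf L m (n + 1) U j b : 𝔸) - 1‖ ≤ εU j)
        (_hLb : ∀ (j : ℕ) (b : Bond d (towerP L m (j + 1))), UlevOf L m (n + 1) U j b ∈ U1 𝔸)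
        (α : ℝ) (_hα : 0 ≤ α) (_hαle : α ≤ α₁)
        (hUst : ∀ b, star (U b : 𝔸) = (((U b)⁻¹ : 𝔸ˣ) : 𝔸)) (_hUb : ∀ b, U b ∈ U1 𝔸) (_hUη : ∀ b, ‖(U b : 𝔸) - 1‖ ≤ α * η)
        (_hpl : ∀ p : B9SectCLatticeCarrier.Plaq d (towerP L m (n + 1)), ‖(plaqHolU U p : 𝔸) - 1‖ ≤ α * η ^ 2)
        (_hUgrad : ∀ (x : TSite d (towerP L m (n + 1))) (μ : Fin d), ‖(U (x, μ) : 𝔸) - U (unshift μ x, μ)‖ ≤ α * η ^ 2)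
        (_hRlev : ∀ (j : ℕ) (b : Bond d (towerP L m (j + 1))) (w : W), ‖adTransportW φ (UlevOf L m (n + 1) U j) b w‖ ≤ ‖w‖)
        (_hεg : ∀ j < n + 1, εU j ≤ α * ϱ ^ j) (_hAQ : ∑ j ∈ Finset.range (n + 1), αU j ≤ AQ)
        (hpos' : ∀ x : SiteL2K ℂ d (towerP L m (n + 1)) c₀ W, x ≠ 0 → 0 < RCLike.re ⟪x, laplacePrimeAk L m n φ η U a' (c₁ := c₁) x⟫_ℂ)
        (hpos : ∀ x : BondL2K ℂ d (towerP L m (n + 1)) c₀ W, x ≠ 0 →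
          0 < RCLike.re ⟪x, laplaceAk L m n φ η U hL αU hα1 hU1 hreg τ (c₀ := c₀) (c₁ := c₁) a x⟫_ℂ)
        (_hc₀η : c₀ = η ^ d) (j₀ : ℝ) (_hJ : ∀ μ y, ‖B9Eq39Adjoint.J (fun μ => B9Eq33CovDerivVector.shiftEquiv μ) (fun μ y => U (y, μ)) η μ y‖ ≤ j₀) (_hj : j₀ ≤ j₁)
        (hposπ : ∀ x : BondL2K ℂ d (towerP L m (n + 1)) c₀ W, x ≠ 0 →
          0 < RCLike.re ⟪x, laplaceAkPi L m n φ τ η U a' hpos' hL αU hα1 hU1 hreg (c₁ := c₁) a x⟫_ℂ)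
        (hQ : Function.Surjective (QkW L m n φ U hL αU hα1 hU1 hreg (c₀ := c₀) (c₁ := c₁)))
        (g : BondL2K ℂ d (towerP L m (n + 1)) c₀ W) (M : ℝ) (_hM : 0 ≤ M)
        (_hgM : ∀ b, ‖WL2.equiv ℂ (fun _ : Bond d (towerP L m (n + 1)) => c₀) W g b‖ ≤ M) (y : Bond d m),
        ‖WL2.equiv ℂ (fun _ : Bond d m => c₁) W
            (ContinuousLinearMap.adjoint (LinearMap.toContinuousLinearMap (H1LatticeK hposπ hQ)) g) y‖ ≤ B * M := by
  classical
  obtain ⟨α₁, j₁, B, δ, hα₁, hj₁, hB, hδ, HA⟩ :=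
    exists_local_letter_adjoint_H1LatticeKPi hd L hL hL3 φ hMφ hMφ' hφ hφ' hstar ha ha' hϱ0 hϱ1 τ hτ hCτ hτm hMτ hρw hτ₁ hτ₂ hφτ AQ
  have hK : 0 ≤ latticeConst d δ := latticeConst_nonneg d hδ.le
  refine ⟨α₁, j₁, B * d * latticeConst d δ, hα₁, hj₁, by positivity, ?_⟩
  intro n η hηL c₀ c₁ _ _ hw hρ m _ hm U αU hα0 hα1 hαL hU1 hreg εU hεU hUε hLb α hα hαle hUst hUb hUη hpl hUgrad hRlev hεg hAQ hpos' hpos hc₀η j₀ hJ hj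
    hposπ hQ g M hM0 hgM y
  -- `H̃_k†` read on the plain functions (fine bonds → coarse bonds)
  obtain ⟨TA, hTA⟩ : ∃ T : (Bond d (towerP L m (n + 1)) → W) →ₗ[ℂ] (Bond d m → W),
      ∀ f x, T f x = WL2.equiv ℂ (fun _ : Bond d m => c₁) W
        (ContinuousLinearMap.adjoint (LinearMap.toContinuousLinearMap (H1LatticeK hposπ hQ))
          (((WL2.equiv ℂ (fun _ : Bond d (towerP L m (n + 1)) => c₀) W)).symm f)) x :=
    ⟨(WL2.linearEquiv ℂ ℂ (fun _ : Bond d m => c₁)).toLinearMap ∘ₗ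
      ((ContinuousLinearMap.adjoint (LinearMap.toContinuousLinearMap (H1LatticeK hposπ hQ))).toLinearMap) ∘ₗ
      (WL2.linearEquiv ℂ ℂ (fun _ : Bond d (towerP L m (n + 1)) => c₀)).symm.toLinearMap, fun _ _ => rfl⟩
  have hloc : ∀ (v : TSite d m) (f : Bond d (towerP L m (n + 1)) → W) (F : ℝ),
      (∀ b, blockCoord (L ^ (n + 1)) m (siteCast (towerP_eq_fineP_pow L m (n + 1)) (bpos b)) ≠ v → f b = 0) → (∀ b, ‖f b‖ ≤ F) →
      ∀ x, ‖TA f x‖ ≤ B * d * Real.exp (-(δ * tdist m (bpos x) v)) * F := by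
    intro v f F hfv hfF x
    rw [hTA]
    exact HA n η hηL c₀ c₁ hw hρ m hm U αU hα0 hα1 hαL hU1 hreg εU hεU hUε hLb α hα hαle hUst hUb hUη hpl hUgrad hRlev hεg hAQ hpos' hpos hc₀η j₀ hJ hj
      hposπ hQ v (((WL2.equiv ℂ (fun _ : Bond d (towerP L m (n + 1)) => c₀) W)).symm f) F
      (fun b hb => by rw [Equiv.apply_symm_apply]; exact hfv b hb) (fun b => by rw [Equiv.apply_symm_apply]; exact hfF b) x
  have h := norm_apply_le_of_local
    (fun b : Bond d (towerP L m (n + 1)) => blockCoord (L ^ (n + 1)) m (siteCast (towerP_eq_fineP_pow L m (n + 1)) (bpos b)))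
    (fun x : Bond d m => bpos x) (tdist m) TA (by positivity) hloc (fun u => torusSum_le d hm hδ u)
    (WL2.equiv ℂ (fun _ : Bond d (towerP L m (n + 1)) => c₀) W g) hM0 hgM y
  rw [hTA, Equiv.symm_apply_apply] at h
  exact h

end Literature.MathematicalPhysics.QuantumFieldTheory.Balaban1983to89.B9Eq3126H1kPiAdjointRowClosed

end
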